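/-
Copyright (c) 2026 the pub-hodgecm-mathlib formalisation cell (harness21).  Prover seat hodgecm-mathlib-R90-C131-p02 (g0) (R90-TF S4 hand lent to L1
by CHAIR VALVE WORD W4), Track B «K2-LIT», hLiu418 = `stmt-HodgeConjecture-24832`; K1-a♮ line lead K2E5-p16 (g8) DESK NAME 01:27Z «(iii-b-3)», FILE 2b⁻ (negative index).
THEOREMS ONLY (no `def`, no instance, no notation, no named-fact hypothesis, no `sorry`); lane `--supports stmt-HodgeConjecture-24832 --as helper`.
-/
import Summits.HodgeConjecture.HodgeConjecture.Theorems.K2LiuArchPointRayCalculus              -- ★ FILE 1: ray calculus of the point data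
import Summits.HodgeConjecture.HodgeConjecture.Theorems.K2LiuArchRayDerivLetters               -- ★ FILE 2a: composite-derivative letters
import Summits.HodgeConjecture.HodgeConjecture.Theorems.K2LiuArchTwistedScalarLettersExplicit  -- ★ p864004 ∕ p864108: the explicit scalar-type letters (both signs)
import HarnessLib

/-!
# Crux `HLiu418`, (Φ-S1) road B, (iii-b-3) FILE 2b⁻: the RAY DERIVATIVE of the explicit scalar-type arch letter at a NEGATIVE index — `τ ↦ Ac⁻ s (g·exp(τX))` is
# differentiable at `τ = 0` for every `s` with `0 < re s`, with a derivative `D s` HOLOMORPHIC in `s` on `{0 < re s}` (one `D` for all `s`)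

Cell `hodgecm-mathlib`, crux item hLiu418 = `stmt-HodgeConjecture-24832` (helper lane, count-neutral).  The first non-scalar `K_w`-type rung: the twisted
block of `D_X f⁰` at `g` is `d/dτ|₀` of the scalar block at `g·exp(τX)` (★ p863633), and the scalar block is ★ p864004's explicit letter `Ac s (·)`.
THIS FILE differentiates that explicit letter along the ray by the product rule: the `τ`-dependent factors are handled by ★ FILE 1 (differentiability
of every point datum, `det d ≠ 0`, `p > 0`, `q′ > 0`) and ★ FILE 2a (`(r:ℂ)^c`, `f^m`, `Φ_N(·,·,p(τ),s)` letters); the derivative `D s` is an explicit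
polynomial in holomorphic-in-`s` quantities (`‖det d‖^{k−2s−2}`, `(1/q′)^{2s}`, `Γ(2s)`, `Γ⁻¹`'s, `Φ_N(…,s)`, `Φ_N(…,β₀+1,…,s)`) with `s`-independent
real/complex constants (the `τ`-derivatives at `0` of the point data), hence holomorphic on `{0 < re s}`.
* §1 **`exists_hasDerivAt_continuedFormula_ray_neg`**: the sign twin of ★ p864382 over ★ p864108's negative-index formula (`Φ (1 − k/2) (1 + k/2)`, `−k/2 < N`).

HONEST LABEL: scalar letter, negative index; closes no socket.  HC_CM is proved only modulo the 7 printed citations (2 remaining named inputs: hLiu418 = `stmt-HodgeConjecture-24832`,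
h413 = `stmt-HodgeConjecture-24833`) until rung 0 closes.  REL ≠ ★ ≠ BUILT.

## References
* [Knapp1986] A. W. Knapp, *Representation Theory of Semisimple Groups*, Princeton (1986), Ch. VIII §3.
* [Shimura1982] G. Shimura, *Confluent hypergeometric functions on tube domains*, Math. Ann. 260 (1982), §3 Thm. 3.1, §4 Thm. 4.2.
-/

set_option autoImplicit false
set_option linter.dupNamespace false

noncomputable section

open Complex Matrix NormedSpace Set
open scoped ComplexConjugate ComplexOrder

namespace Summit.HodgeConjecture.HodgeConjecture.Cruxes.HLiu418.K2LiuArchTwistedScalarBlockRayDerivNeg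

open Literature.NumberTheory.ModularForms.SiegelUpperHalfSpace (num denom moeb)
open Summit.HodgeConjecture.HodgeConjecture.Cruxes.HLiu418.K2LiuHermTwoGammaDefs
open Summit.HodgeConjecture.HodgeConjecture.Cruxes.HLiu418.K2LiuHermTwoEtaDefs
open Summit.HodgeConjecture.HodgeConjecture.Cruxes.HLiu418.K2LiuHermitianTubeCocycle (mul_mem_UJ isUnit_det_denom posDef_im_moeb posDef_im_I_smul_one)
open Summit.HodgeConjecture.HodgeConjecture.Cruxes.HLiu418.K2LiuArchInducedTubeDefs
open Summit.HodgeConjecture.HodgeConjecture.Cruxes.HLiu418.K2LiuLocalKernelArchPlaceFactor (differentiableOn_Gamma_two_mul)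
open Summit.HodgeConjecture.HodgeConjecture.Cruxes.HLiu418.K2LiuArchScalarSectionCurveDerivative (exp_zero_smul_eq_one)
open Summit.HodgeConjecture.HodgeConjecture.Cruxes.HLiu418.K2LiuArchPointRayCalculus
open Summit.HodgeConjecture.HodgeConjecture.Cruxes.HLiu418.K2LiuArchRayDerivLetters

/-! ## §1 The ray derivative of the explicit letter, negative index -/

/-- **THE RAY DERIVATIVE OF THE EXPLICIT SCALAR-TYPE ARCH LETTER, NEGATIVE INDEX `−a·diag(t,0)·aᴴ`.**  For `g ∈ U(J)`, `X ∈ 𝔲(J)`, `‖det a‖ = 1`, `t : ℝ`, `k/2 < N`, and the universal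
witness `Φ` of ★ (ii) (clauses (a), (d)), `−k/2 < N`: ONE `D`, holomorphic on `{0 < re s}`, with `HasDerivAt (τ ↦ Ac⁻ s (g·exp(τX))) (D s) 0` for every `s` with
`0 < re s`, `Ac⁻` = ★ p864108's negative-index explicit letter. [Knapp1986, Ch. VIII §3] [Shimura1982, §4 Thm. 4.2] -/
theorem exists_hasDerivAt_continuedFormula_ray_neg (k : ℤ) {g X : Matrix (Fin 2 ⊕ Fin 2) (Fin 2 ⊕ Fin 2) ℂ}
    (hg : gᴴ * Matrix.J (Fin 2) ℂ * g = Matrix.J (Fin 2) ℂ) (hX : Xᴴ * Matrix.J (Fin 2) ℂ + Matrix.J (Fin 2) ℂ * X = 0)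
    {a : Matrix (Fin 2) (Fin 2) ℂ} (hdet : ‖a.det‖ = 1) (t : ℝ) {N : ℕ} (hN : -(k : ℝ) / 2 < N)
    (Φ : ℂ → ℂ → ℝ → ℂ → ℂ)
    (hΦa : ∀ (α₀ β₀ : ℂ) (p' : ℝ), 0 < p' → DifferentiableOn ℂ (Φ α₀ β₀ p') {s : ℂ | 1 - N < (β₀ + s).re})
    (hΦd : ∀ (α₀ β₀ : ℂ) (p : ℝ), 0 < p → ∀ s : ℂ, 1 - (N : ℝ) < (β₀ + s).re →
      HasDerivAt (fun p' : ℝ => Φ α₀ β₀ p' s) (-(β₀ + s - 1) * Φ α₀ (β₀ + 1) p s) p) :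
    ∃ Dv : ℂ → ℂ, DifferentiableOn ℂ Dv {s : ℂ | 0 < s.re} ∧ ∀ s : ℂ, 0 < s.re →
      HasDerivAt (fun τ : ℝ =>
        ((denom (g * NormedSpace.exp (τ • X)) (I • (1 : Matrix (Fin 2) (Fin 2) ℂ))).det ^ (-k) *
            (((‖(denom (g * NormedSpace.exp (τ • X)) (I • (1 : Matrix (Fin 2) (Fin 2) ℂ))).det‖ : ℝ)) : ℂ) ^ ((k : ℂ) - 2 * s - 2) *
            cexp ((2 * Real.pi * I) * ((-(a * hermTwo (t, 0, 0) * aᴴ)) * ((2 : ℂ)⁻¹ • (moeb (g * NormedSpace.exp (τ • X)) (I • (1 : Matrix (Fin 2) (Fin 2) ℂ)) + (moeb (g * NormedSpace.exp (τ • X)) (I • (1 : Matrix (Fin 2) (Fin 2) ℂ)))ᴴ))).trace)) *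
          ((1 / 8 : ℂ) * ((((4 * Real.pi ^ 4 : ℝ)) : ℂ) * cexp ((Real.pi * I) * ((s + 1 - k / 2) - (s + 1 + k / 2))) *
            ((Real.pi : ℂ)⁻¹ * (Complex.Gamma (s + 1 + k / 2))⁻¹) *
            ((Real.pi : ℂ)⁻¹ * (Complex.Gamma (s + 1 - k / 2))⁻¹ * (Complex.Gamma (s + 1 - k / 2 - 1))⁻¹) *
            ((Real.pi : ℂ) / (((aᴴ * ((2 : ℂ) • ((2 * I)⁻¹ • (moeb (g * NormedSpace.exp (τ • X)) (I • (1 : Matrix (Fin 2) (Fin 2) ℂ)) - (moeb (g * NormedSpace.exp (τ • X)) (I • (1 : Matrix (Fin 2) (Fin 2) ℂ)))ᴴ))) * a) 0 0).re) * cexp (-(((((aᴴ * ((2 : ℂ) • ((2 * I)⁻¹ • (moeb (g * NormedSpace.exp (τ • X)) (I • (1 : Matrix (Fin 2) (Fin 2) ℂ)) - (moeb (g * NormedSpace.exp (τ • X)) (I • (1 : Matrix (Fin 2) (Fin 2) ℂ)))ᴴ))) * a) 0 0).re) * (Real.pi * t) : ℝ) : ℂ)) *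
              ((1 / (((((aᴴ * ((2 : ℂ) • ((2 * I)⁻¹ • (moeb (g * NormedSpace.exp (τ • X)) (I • (1 : Matrix (Fin 2) (Fin 2) ℂ)) - (moeb (g * NormedSpace.exp (τ • X)) (I • (1 : Matrix (Fin 2) (Fin 2) ℂ)))ᴴ))) * a) 1 1).re) - normSq ((aᴴ * ((2 : ℂ) • ((2 * I)⁻¹ • (moeb (g * NormedSpace.exp (τ • X)) (I • (1 : Matrix (Fin 2) (Fin 2) ℂ)) - (moeb (g * NormedSpace.exp (τ • X)) (I • (1 : Matrix (Fin 2) (Fin 2) ℂ)))ᴴ))) * a) 0 1) / (((aᴴ * ((2 : ℂ) • ((2 * I)⁻¹ • (moeb (g * NormedSpace.exp (τ • X)) (I • (1 : Matrix (Fin 2) (Fin 2) ℂ)) - (moeb (g * NormedSpace.exp (τ • X)) (I • (1 : Matrix (Fin 2) (Fin 2) ℂ)))ᴴ))) * a) 0 0).re) : ℝ) : ℂ)) ^ ((s + 1 - k / 2) + (s + 1 + k / 2) - 2) * Complex.Gamma (2 * s)) *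
            Φ (1 - k / 2) (1 + k / 2) (((aᴴ * ((2 : ℂ) • ((2 * I)⁻¹ • (moeb (g * NormedSpace.exp (τ • X)) (I • (1 : Matrix (Fin 2) (Fin 2) ℂ)) - (moeb (g * NormedSpace.exp (τ • X)) (I • (1 : Matrix (Fin 2) (Fin 2) ℂ)))ᴴ))) * a) 0 0).re) s)))) (Dv s) 0 := by
  have ha0 : a.det ≠ 0 := fun h0 => by rw [h0, norm_zero] at hdet; exact zero_ne_one hdet
  have haU : IsUnit a := (Matrix.isUnit_iff_isUnit_det a).mpr (Ne.isUnit ha0)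
  obtain ⟨hdet0, hρd, hUd, hpd, hppos, hqd, hqpos⟩ := differentiable_pointData_mul_exp hg hX haU
  -- the s-independent atoms and their derivatives at 0 (opaque constants)
  have hf1 : HasDerivAt (fun τ : ℝ => (denom (g * NormedSpace.exp (τ • X)) (I • (1 : Matrix (Fin 2) (Fin 2) ℂ))).det) (deriv (fun τ : ℝ => (denom (g * NormedSpace.exp (τ • X)) (I • (1 : Matrix (Fin 2) (Fin 2) ℂ))).det) 0) 0 := (differentiable_det_denom g X 0).hasDerivAt
  have hρ : HasDerivAt (fun τ : ℝ => ‖(denom (g * NormedSpace.exp (τ • X)) (I • (1 : Matrix (Fin 2) (Fin 2) ℂ))).det‖) (deriv (fun τ : ℝ => ‖(denom (g * NormedSpace.exp (τ • X)) (I • (1 : Matrix (Fin 2) (Fin 2) ℂ))).det‖) 0) 0 := (hρd 0).hasDerivAt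
  have hu : HasDerivAt (fun τ : ℝ => ((-(a * hermTwo (t, 0, 0) * aᴴ)) * ((2 : ℂ)⁻¹ • (moeb (g * NormedSpace.exp (τ • X)) (I • (1 : Matrix (Fin 2) (Fin 2) ℂ)) + (moeb (g * NormedSpace.exp (τ • X)) (I • (1 : Matrix (Fin 2) (Fin 2) ℂ)))ᴴ))).trace) (deriv (fun τ : ℝ => ((-(a * hermTwo (t, 0, 0) * aᴴ)) * ((2 : ℂ)⁻¹ • (moeb (g * NormedSpace.exp (τ • X)) (I • (1 : Matrix (Fin 2) (Fin 2) ℂ)) + (moeb (g * NormedSpace.exp (τ • X)) (I • (1 : Matrix (Fin 2) (Fin 2) ℂ)))ᴴ))).trace) 0) 0 := by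
    have hdiff : Differentiable ℝ (fun τ : ℝ => ((-(a * hermTwo (t, 0, 0) * aᴴ)) * ((2 : ℂ)⁻¹ • (moeb (g * NormedSpace.exp (τ • X)) (I • (1 : Matrix (Fin 2) (Fin 2) ℂ)) + (moeb (g * NormedSpace.exp (τ • X)) (I • (1 : Matrix (Fin 2) (Fin 2) ℂ)))ᴴ))).trace) := by
      have h : (fun τ : ℝ => ((-(a * hermTwo (t, 0, 0) * aᴴ)) * ((2 : ℂ)⁻¹ • (moeb (g * NormedSpace.exp (τ • X)) (I • (1 : Matrix (Fin 2) (Fin 2) ℂ)) + (moeb (g * NormedSpace.exp (τ • X)) (I • (1 : Matrix (Fin 2) (Fin 2) ℂ)))ᴴ))).trace) = fun τ : ℝ => ∑ i, ∑ q, (-(a * hermTwo (t, 0, 0) * aᴴ)) i q * ((2 : ℂ)⁻¹ • (moeb (g * NormedSpace.exp (τ • X)) (I • (1 : Matrix (Fin 2) (Fin 2) ℂ)) + (moeb (g * NormedSpace.exp (τ • X)) (I • (1 : Matrix (Fin 2) (Fin 2) ℂ)))ᴴ)) q i := by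
        funext τ; rw [Matrix.trace]; simp only [Matrix.diag_apply, Matrix.mul_apply]
      rw [h]
      exact Differentiable.fun_sum fun i _ => Differentiable.fun_sum fun q _ => (differentiable_const _).mul (hUd q i)
    exact (hdiff 0).hasDerivAt
  have hp : HasDerivAt (fun τ : ℝ => (((aᴴ * ((2 : ℂ) • ((2 * I)⁻¹ • (moeb (g * NormedSpace.exp (τ • X)) (I • (1 : Matrix (Fin 2) (Fin 2) ℂ)) - (moeb (g * NormedSpace.exp (τ • X)) (I • (1 : Matrix (Fin 2) (Fin 2) ℂ)))ᴴ))) * a) 0 0).re)) (deriv (fun τ : ℝ => (((aᴴ * ((2 : ℂ) • ((2 * I)⁻¹ • (moeb (g * NormedSpace.exp (τ • X)) (I • (1 : Matrix (Fin 2) (Fin 2) ℂ)) - (moeb (g * NormedSpace.exp (τ • X)) (I • (1 : Matrix (Fin 2) (Fin 2) ℂ)))ᴴ))) * a) 0 0).re)) 0) 0 := (hpd 0).hasDerivAt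
  have hq : HasDerivAt (fun τ : ℝ => ((((aᴴ * ((2 : ℂ) • ((2 * I)⁻¹ • (moeb (g * NormedSpace.exp (τ • X)) (I • (1 : Matrix (Fin 2) (Fin 2) ℂ)) - (moeb (g * NormedSpace.exp (τ • X)) (I • (1 : Matrix (Fin 2) (Fin 2) ℂ)))ᴴ))) * a) 1 1).re) - normSq ((aᴴ * ((2 : ℂ) • ((2 * I)⁻¹ • (moeb (g * NormedSpace.exp (τ • X)) (I • (1 : Matrix (Fin 2) (Fin 2) ℂ)) - (moeb (g * NormedSpace.exp (τ • X)) (I • (1 : Matrix (Fin 2) (Fin 2) ℂ)))ᴴ))) * a) 0 1) / (((aᴴ * ((2 : ℂ) • ((2 * I)⁻¹ • (moeb (g * NormedSpace.exp (τ • X)) (I • (1 : Matrix (Fin 2) (Fin 2) ℂ)) - (moeb (g * NormedSpace.exp (τ • X)) (I • (1 : Matrix (Fin 2) (Fin 2) ℂ)))ᴴ))) * a) 0 0).re) : ℝ)) (deriv (fun τ : ℝ => ((((aᴴ * ((2 : ℂ) • ((2 * I)⁻¹ • (moeb (g * NormedSpace.exp (τ • X)) (I • (1 : Matrix (Fin 2)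 (Fin 2) ℂ)) - (moeb (g * NormedSpace.exp (τ • X)) (I • (1 : Matrix (Fin 2) (Fin 2) ℂ)))ᴴ))) * a) 1 1).re) - normSq ((aᴴ * ((2 : ℂ) • ((2 * I)⁻¹ • (moeb (g * NormedSpace.exp (τ • X)) (I • (1 : Matrix (Fin 2) (Fin 2) ℂ)) - (moeb (g * NormedSpace.exp (τ • X)) (I • (1 : Matrix (Fin 2) (Fin 2) ℂ)))ᴴ))) * a) 0 1) / (((aᴴ * ((2 : ℂ) • ((2 * I)⁻¹ • (moeb (g * NormedSpace.exp (τ • X)) (I • (1 : Matrix (Fin 2) (Fin 2) ℂ)) - (moeb (g * NormedSpace.exp (τ • X)) (I • (1 : Matrix (Fin 2) (Fin 2) ℂ)))ᴴ))) * a) 0 0).re) : ℝ)) 0) 0 := (hqd 0).hasDerivAt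
  have hR1 : HasDerivAt (fun τ : ℝ => (Real.pi : ℂ) / (((aᴴ * ((2 : ℂ) • ((2 * I)⁻¹ • (moeb (g * NormedSpace.exp (τ • X)) (I • (1 : Matrix (Fin 2) (Fin 2) ℂ)) - (moeb (g * NormedSpace.exp (τ • X)) (I • (1 : Matrix (Fin 2) (Fin 2) ℂ)))ᴴ))) * a) 0 0).re) * cexp (-(((((aᴴ * ((2 : ℂ) • ((2 * I)⁻¹ • (moeb (g * NormedSpace.exp (τ • X)) (I • (1 : Matrix (Fin 2) (Fin 2) ℂ)) - (moeb (g * NormedSpace.exp (τ • X)) (I • (1 : Matrix (Fin 2) (Fin 2) ℂ)))ᴴ))) * a) 0 0).re) * (Real.pi * t) : ℝ) : ℂ))) (deriv (fun τ : ℝ => (Real.pi : ℂ) / (((aᴴ * ((2 : ℂ) • ((2 * I)⁻¹ • (moeb (g * NormedSpace.exp (τ • X)) (I • (1 : Matrix (Fin 2) (Fin 2) ℂ)) - (moeb (g * NormedSpace.exp (τ • X)) (I • (1 : Matrix (Fin 2) (Fin 2) ℂ)))ᴴ))) * a) 0 0).re) * cexp (-(((((aᴴ * ((2 : ℂ) •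 ((2 * I)⁻¹ • (moeb (g * NormedSpace.exp (τ • X)) (I • (1 : Matrix (Fin 2) (Fin 2) ℂ)) - (moeb (g * NormedSpace.exp (τ • X)) (I • (1 : Matrix (Fin 2) (Fin 2) ℂ)))ᴴ))) * a) 0 0).re) * (Real.pi * t) : ℝ) : ℂ))) 0) 0 := by
    have hpc : Differentiable ℝ (fun τ : ℝ => (((((aᴴ * ((2 : ℂ) • ((2 * I)⁻¹ • (moeb (g * NormedSpace.exp (τ • X)) (I • (1 : Matrix (Fin 2) (Fin 2) ℂ)) - (moeb (g * NormedSpace.exp (τ • X)) (I • (1 : Matrix (Fin 2) (Fin 2) ℂ)))ᴴ))) * a) 0 0).re) : ℝ) : ℂ)) := Complex.ofRealCLM.differentiable.comp hpd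
    have h1 : Differentiable ℝ (fun τ : ℝ => (Real.pi : ℂ) / (((((aᴴ * ((2 : ℂ) • ((2 * I)⁻¹ • (moeb (g * NormedSpace.exp (τ • X)) (I • (1 : Matrix (Fin 2) (Fin 2) ℂ)) - (moeb (g * NormedSpace.exp (τ • X)) (I • (1 : Matrix (Fin 2) (Fin 2) ℂ)))ᴴ))) * a) 0 0).re) : ℝ) : ℂ)) :=
      (differentiable_const _).div hpc fun τ => by exact_mod_cast (hppos τ).ne'
    have h2 : Differentiable ℝ (fun τ : ℝ => cexp (-((((((aᴴ * ((2 : ℂ) • ((2 * I)⁻¹ • (moeb (g * NormedSpace.exp (τ • X)) (I • (1 : Matrix (Fin 2) (Fin 2) ℂ)) - (moeb (g * NormedSpace.exp (τ • X)) (I • (1 : Matrix (Fin 2) (Fin 2) ℂ)))ᴴ))) * a) 0 0).re) * (Real.pi * t) : ℝ)) : ℂ))) :=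
      (Complex.ofRealCLM.differentiable.comp (hpd.mul_const _)).neg.cexp
    exact ((h1.mul h2) 0).hasDerivAt
  -- positivity at 0
  have hρ0 : 0 < (fun τ : ℝ => ‖(denom (g * NormedSpace.exp (τ • X)) (I • (1 : Matrix (Fin 2) (Fin 2) ℂ))).det‖) 0 := norm_pos_iff.mpr (hdet0 0)
  have hq0 : 0 < (fun τ : ℝ => 1 / ((((aᴴ * ((2 : ℂ) • ((2 * I)⁻¹ • (moeb (g * NormedSpace.exp (τ • X)) (I • (1 : Matrix (Fin 2) (Fin 2) ℂ)) - (moeb (g * NormedSpace.exp (τ • X)) (I • (1 : Matrix (Fin 2) (Fin 2) ℂ)))ᴴ))) * a) 1 1).re) - normSq ((aᴴ * ((2 : ℂ) • ((2 * I)⁻¹ • (moeb (g * NormedSpace.exp (τ • X)) (I • (1 : Matrix (Fin 2) (Fin 2) ℂ)) - (moeb (g * NormedSpace.exp (τ • X)) (I • (1 : Matrix (Fin 2) (Fin 2) ℂ)))ᴴ))) * a) 0 1) / (((aᴴ * ((2 : ℂ) • ((2 * I)⁻¹ • (moeb (g * NormedSpace.exp (τ • X)) (I • (1 : Matrix (Fin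 2) (Fin 2) ℂ)) - (moeb (g * NormedSpace.exp (τ • X)) (I • (1 : Matrix (Fin 2) (Fin 2) ℂ)))ᴴ))) * a) 0 0).re) : ℝ)) 0 := one_div_pos.mpr (hqpos 0)
  have hqinv : HasDerivAt (fun τ : ℝ => 1 / ((((aᴴ * ((2 : ℂ) • ((2 * I)⁻¹ • (moeb (g * NormedSpace.exp (τ • X)) (I • (1 : Matrix (Fin 2) (Fin 2) ℂ)) - (moeb (g * NormedSpace.exp (τ • X)) (I • (1 : Matrix (Fin 2) (Fin 2) ℂ)))ᴴ))) * a) 1 1).re) - normSq ((aᴴ * ((2 : ℂ) • ((2 * I)⁻¹ • (moeb (g * NormedSpace.exp (τ • X)) (I • (1 : Matrix (Fin 2) (Fin 2) ℂ)) - (moeb (g * NormedSpace.exp (τ • X)) (I • (1 : Matrix (Fin 2) (Fin 2) ℂ)))ᴴ))) * a) 0 1) / (((aᴴ * ((2 : ℂ) • ((2 * I)⁻¹ • (moeb (g * NormedSpace.exp (τ • X)) (I • (1 : Matrix (Fin 2) (Fin 2) ℂ)) - (moeb (g * NormedSpace.exp (τ • X)) (I • (1 : Matrix (Fin 2) (Fin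 2) ℂ)))ᴴ))) * a) 0 0).re) : ℝ)) (deriv (fun τ : ℝ => 1 / ((((aᴴ * ((2 : ℂ) • ((2 * I)⁻¹ • (moeb (g * NormedSpace.exp (τ • X)) (I • (1 : Matrix (Fin 2) (Fin 2) ℂ)) - (moeb (g * NormedSpace.exp (τ • X)) (I • (1 : Matrix (Fin 2) (Fin 2) ℂ)))ᴴ))) * a) 1 1).re) - normSq ((aᴴ * ((2 : ℂ) • ((2 * I)⁻¹ • (moeb (g * NormedSpace.exp (τ • X)) (I • (1 : Matrix (Fin 2) (Fin 2) ℂ)) - (moeb (g * NormedSpace.exp (τ • X)) (I • (1 : Matrix (Fin 2) (Fin 2) ℂ)))ᴴ))) * a) 0 1) / (((aᴴ * ((2 : ℂ) • ((2 * I)⁻¹ • (moeb (g * NormedSpace.exp (τ • X)) (I • (1 : Matrix (Fin 2) (Fin 2) ℂ)) - (moeb (g * NormedSpace.exp (τ • X)) (I • (1 : Matrix (Fin 2) (Fin 2) ℂ)))ᴴ))) * a) 0 0).re) : ℝ)) 0) 0 :=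
    (((differentiable_const (1 : ℝ)).div hqd fun τ => (hqpos τ).ne') 0).hasDerivAt
  -- the τ-dependent factors, for every `s` (term-mode, so that the product's derivative term is INFERRED)
  have hX1 : HasDerivAt (fun τ : ℝ => (fun τ : ℝ => (denom (g * NormedSpace.exp (τ • X)) (I • (1 : Matrix (Fin 2) (Fin 2) ℂ))).det) τ ^ (-k)) ((((-k : ℤ)) : ℂ) * (fun τ : ℝ => (denom (g * NormedSpace.exp (τ • X)) (I • (1 : Matrix (Fin 2) (Fin 2) ℂ))).det) 0 ^ (-k - 1) * deriv (fun τ : ℝ => (denom (g * NormedSpace.exp (τ • X)) (I • (1 : Matrix (Fin 2) (Fin 2) ℂ))).det) 0) 0 :=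
    hasDerivAt_zpow_comp hf1 (hdet0 0) (-k)
  have hX2 : ∀ s : ℂ, HasDerivAt (fun τ : ℝ => ((((fun τ : ℝ => ‖(denom (g * NormedSpace.exp (τ • X)) (I • (1 : Matrix (Fin 2) (Fin 2) ℂ))).det‖) τ : ℝ)) : ℂ) ^ ((k : ℂ) - 2 * s - 2))
      (((k : ℂ) - 2 * s - 2) * ((((fun τ : ℝ => ‖(denom (g * NormedSpace.exp (τ • X)) (I • (1 : Matrix (Fin 2) (Fin 2) ℂ))).det‖) 0 : ℝ)) : ℂ) ^ (((k : ℂ) - 2 * s - 2) - 1) * ((deriv (fun τ : ℝ => ‖(denom (g * NormedSpace.exp (τ • X)) (I • (1 : Matrix (Fin 2) (Fin 2) ℂ))).det‖) 0 : ℝ) : ℂ)) 0 := fun s =>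
    hasDerivAt_ofReal_cpow_const hρ hρ0 _
  have hX3 : HasDerivAt (fun τ : ℝ => cexp ((2 * Real.pi * I) * (fun τ : ℝ => ((-(a * hermTwo (t, 0, 0) * aᴴ)) * ((2 : ℂ)⁻¹ • (moeb (g * NormedSpace.exp (τ • X)) (I • (1 : Matrix (Fin 2) (Fin 2) ℂ)) + (moeb (g * NormedSpace.exp (τ • X)) (I • (1 : Matrix (Fin 2) (Fin 2) ℂ)))ᴴ))).trace) τ))
      (cexp ((2 * Real.pi * I) * (fun τ : ℝ => ((-(a * hermTwo (t, 0, 0) * aᴴ)) * ((2 : ℂ)⁻¹ • (moeb (g * NormedSpace.exp (τ • X)) (I • (1 : Matrix (Fin 2) (Fin 2) ℂ)) + (moeb (g * NormedSpace.exp (τ • X)) (I • (1 : Matrix (Fin 2) (Fin 2) ℂ)))ᴴ))).trace) 0) * ((2 * Real.pi * I) * deriv (fun τ : ℝ => ((-(a * hermTwo (t, 0, 0) * aᴴ)) * ((2 : ℂ)⁻¹ • (moeb (g * NormedSpace.exp (τ • X)) (I • (1 : Matrix (Fin 2) (Fin 2) ℂ)) + (moeb (g * NormedSpace.exp (τ •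 X)) (I • (1 : Matrix (Fin 2) (Fin 2) ℂ)))ᴴ))).trace) 0)) 0 := (hu.const_mul _).cexp
  have hX6 : ∀ s : ℂ, HasDerivAt (fun τ : ℝ => (1 / ((((((aᴴ * ((2 : ℂ) • ((2 * I)⁻¹ • (moeb (g * NormedSpace.exp (τ • X)) (I • (1 : Matrix (Fin 2) (Fin 2) ℂ)) - (moeb (g * NormedSpace.exp (τ • X)) (I • (1 : Matrix (Fin 2) (Fin 2) ℂ)))ᴴ))) * a) 1 1).re) - normSq ((aᴴ * ((2 : ℂ) • ((2 * I)⁻¹ • (moeb (g * NormedSpace.exp (τ • X)) (I • (1 : Matrix (Fin 2) (Fin 2) ℂ)) - (moeb (g * NormedSpace.exp (τ • X)) (I • (1 : Matrix (Fin 2) (Fin 2) ℂ)))ᴴ))) * a) 0 1) / (((aᴴ * ((2 : ℂ) • ((2 * I)⁻¹ • (moeb (g * NormedSpace.exp (τ • X)) (I • (1 : Matrix (Fin 2) (Fin 2) ℂ)) - (moeb (g * NormedSpace.exp (τ • X)) (I • (1 : Matrix (Fin 2) (Fin 2) ℂ)))ᴴ))) * a) 0 0).re) : ℝ)) : ℂ))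 ^ ((s + 1 - k / 2) + (s + 1 + k / 2) - 2))
      (((s + 1 - k / 2) + (s + 1 + k / 2) - 2) * ((((fun τ : ℝ => 1 / ((((aᴴ * ((2 : ℂ) • ((2 * I)⁻¹ • (moeb (g * NormedSpace.exp (τ • X)) (I • (1 : Matrix (Fin 2) (Fin 2) ℂ)) - (moeb (g * NormedSpace.exp (τ • X)) (I • (1 : Matrix (Fin 2) (Fin 2) ℂ)))ᴴ))) * a) 1 1).re) - normSq ((aᴴ * ((2 : ℂ) • ((2 * I)⁻¹ • (moeb (g * NormedSpace.exp (τ • X)) (I • (1 : Matrix (Fin 2) (Fin 2) ℂ)) - (moeb (g * NormedSpace.exp (τ • X)) (I • (1 : Matrix (Fin 2) (Fin 2) ℂ)))ᴴ))) * a) 0 1) / (((aᴴ * ((2 : ℂ) • ((2 * I)⁻¹ • (moeb (g * NormedSpace.exp (τ • X)) (I • (1 : Matrix (Fin 2) (Fin 2) ℂ)) - (moeb (g * NormedSpace.exp (τ • X)) (I • (1 : Matrix (Fin 2) (Fin 2) ℂ)))ᴴ))) * a) 0 0).re) : ℝ)) 0 : ℝ)) : ℂ) ^ (((s + 1 - k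 / 2) + (s + 1 + k / 2) - 2) - 1) * ((deriv (fun τ : ℝ => 1 / ((((aᴴ * ((2 : ℂ) • ((2 * I)⁻¹ • (moeb (g * NormedSpace.exp (τ • X)) (I • (1 : Matrix (Fin 2) (Fin 2) ℂ)) - (moeb (g * NormedSpace.exp (τ • X)) (I • (1 : Matrix (Fin 2) (Fin 2) ℂ)))ᴴ))) * a) 1 1).re) - normSq ((aᴴ * ((2 : ℂ) • ((2 * I)⁻¹ • (moeb (g * NormedSpace.exp (τ • X)) (I • (1 : Matrix (Fin 2) (Fin 2) ℂ)) - (moeb (g * NormedSpace.exp (τ • X)) (I • (1 : Matrix (Fin 2) (Fin 2) ℂ)))ᴴ))) * a) 0 1) / (((aᴴ * ((2 : ℂ) • ((2 * I)⁻¹ • (moeb (g * NormedSpace.exp (τ • X)) (I • (1 : Matrix (Fin 2) (Fin 2) ℂ)) - (moeb (g * NormedSpace.exp (τ • X)) (I • (1 : Matrix (Fin 2) (Fin 2) ℂ)))ᴴ))) * a) 0 0).re) : ℝ)) 0 : ℝ) : ℂ)) 0 := fun s => by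
    refine (hasDerivAt_ofReal_cpow_const hqinv hq0 _).congr_of_eventuallyEq (Filter.Eventually.of_forall fun τ => ?_)
    simp only [one_div, Complex.ofReal_inv]
  have hX8 : ∀ s : ℂ, 0 < s.re → HasDerivAt (fun τ : ℝ => Φ (1 - k / 2) (1 + k / 2) ((fun τ : ℝ => (((aᴴ * ((2 : ℂ) • ((2 * I)⁻¹ • (moeb (g * NormedSpace.exp (τ • X)) (I • (1 : Matrix (Fin 2) (Fin 2) ℂ)) - (moeb (g * NormedSpace.exp (τ • X)) (I • (1 : Matrix (Fin 2) (Fin 2) ℂ)))ᴴ))) * a) 0 0).re)) τ) s)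
      (((deriv (fun τ : ℝ => (((aᴴ * ((2 : ℂ) • ((2 * I)⁻¹ • (moeb (g * NormedSpace.exp (τ • X)) (I • (1 : Matrix (Fin 2) (Fin 2) ℂ)) - (moeb (g * NormedSpace.exp (τ • X)) (I • (1 : Matrix (Fin 2) (Fin 2) ℂ)))ᴴ))) * a) 0 0).re)) 0 : ℝ) : ℂ) * (-((1 + (k : ℂ) / 2) + s - 1) * Φ (1 - k / 2) ((1 + (k : ℂ) / 2) + 1) ((fun τ : ℝ => (((aᴴ * ((2 : ℂ) • ((2 * I)⁻¹ • (moeb (g * NormedSpace.exp (τ • X)) (I • (1 : Matrix (Fin 2) (Fin 2) ℂ)) - (moeb (g * NormedSpace.exp (τ • X)) (I • (1 : Matrix (Fin 2) (Fin 2) ℂ)))ᴴ))) * a) 0 0).re)) 0) s)) 0 := by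
    intro s hs
    have hsβ : 1 - (N : ℝ) < ((1 + (k : ℂ) / 2) + s).re := by
      simp only [add_re, one_re, div_ofNat_re, intCast_re] at hs ⊢; linarith
    exact hasDerivAt_comp_weightParam Φ hΦd (1 - k / 2) (1 + k / 2) hp (hppos 0) hsβ
  -- the product rule, its derivative term inferred
  have key := fun (s : ℂ) (hs : 0 < s.re) =>
    ((hX1.fun_mul (hX2 s)).fun_mul hX3).fun_mul
      ((((hR1.fun_mul ((hX6 s).mul_const (Complex.Gamma (2 * s)))).const_mul
        ((((4 * Real.pi ^ 4 : ℝ)) : ℂ) * cexp ((Real.pi * I) * ((s + 1 - k / 2) - (s + 1 + k / 2))) *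
        ((Real.pi : ℂ)⁻¹ * (Complex.Gamma (s + 1 + k / 2))⁻¹) *
        ((Real.pi : ℂ)⁻¹ * (Complex.Gamma (s + 1 - k / 2))⁻¹ * (Complex.Gamma (s + 1 - k / 2 - 1))⁻¹))).fun_mul (hX8 s hs)).const_mul (1 / 8 : ℂ))
  refine ⟨fun s => deriv (fun τ : ℝ =>
        ((denom (g * NormedSpace.exp (τ • X)) (I • (1 : Matrix (Fin 2) (Fin 2) ℂ))).det ^ (-k) *
            (((‖(denom (g * NormedSpace.exp (τ • X)) (I • (1 : Matrix (Fin 2) (Fin 2) ℂ))).det‖ : ℝ)) : ℂ) ^ ((k : ℂ) - 2 * s - 2) *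
            cexp ((2 * Real.pi * I) * ((-(a * hermTwo (t, 0, 0) * aᴴ)) * ((2 : ℂ)⁻¹ • (moeb (g * NormedSpace.exp (τ • X)) (I • (1 : Matrix (Fin 2) (Fin 2) ℂ)) + (moeb (g * NormedSpace.exp (τ • X)) (I • (1 : Matrix (Fin 2) (Fin 2) ℂ)))ᴴ))).trace)) *
          ((1 / 8 : ℂ) * ((((4 * Real.pi ^ 4 : ℝ)) : ℂ) * cexp ((Real.pi * I) * ((s + 1 - k / 2) - (s + 1 + k / 2))) *
            ((Real.pi : ℂ)⁻¹ * (Complex.Gamma (s + 1 + k / 2))⁻¹) *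
            ((Real.pi : ℂ)⁻¹ * (Complex.Gamma (s + 1 - k / 2))⁻¹ * (Complex.Gamma (s + 1 - k / 2 - 1))⁻¹) *
            ((Real.pi : ℂ) / (((aᴴ * ((2 : ℂ) • ((2 * I)⁻¹ • (moeb (g * NormedSpace.exp (τ • X)) (I • (1 : Matrix (Fin 2) (Fin 2) ℂ)) - (moeb (g * NormedSpace.exp (τ • X)) (I • (1 : Matrix (Fin 2) (Fin 2) ℂ)))ᴴ))) * a) 0 0).re) * cexp (-(((((aᴴ * ((2 : ℂ) • ((2 * I)⁻¹ • (moeb (g * NormedSpace.exp (τ • X)) (I • (1 : Matrix (Fin 2) (Fin 2) ℂ)) - (moeb (g * NormedSpace.exp (τ • X)) (I • (1 : Matrix (Fin 2) (Fin 2) ℂ)))ᴴ))) * a) 0 0).re) * (Real.pi * t) : ℝ) : ℂ)) *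
              ((1 / (((((aᴴ * ((2 : ℂ) • ((2 * I)⁻¹ • (moeb (g * NormedSpace.exp (τ • X)) (I • (1 : Matrix (Fin 2) (Fin 2) ℂ)) - (moeb (g * NormedSpace.exp (τ • X)) (I • (1 : Matrix (Fin 2) (Fin 2) ℂ)))ᴴ))) * a) 1 1).re) - normSq ((aᴴ * ((2 : ℂ) • ((2 * I)⁻¹ • (moeb (g * NormedSpace.exp (τ • X)) (I • (1 : Matrix (Fin 2) (Fin 2) ℂ)) - (moeb (g * NormedSpace.exp (τ • X)) (I • (1 : Matrix (Fin 2) (Fin 2) ℂ)))ᴴ))) * a) 0 1) / (((aᴴ * ((2 : ℂ) • ((2 * I)⁻¹ • (moeb (g * NormedSpace.exp (τ • X)) (I • (1 : Matrix (Fin 2) (Fin 2) ℂ)) - (moeb (g * NormedSpace.exp (τ • X)) (I • (1 : Matrix (Fin 2) (Fin 2) ℂ)))ᴴ))) * a) 0 0).re) : ℝ) : ℂ)) ^ ((s + 1 - k / 2) + (s + 1 + k / 2) - 2) * Complex.Gamma (2 * s)) *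
            Φ (1 - k / 2) (1 + k / 2) (((aᴴ * ((2 : ℂ) • ((2 * I)⁻¹ • (moeb (g * NormedSpace.exp (τ • X)) (I • (1 : Matrix (Fin 2) (Fin 2) ℂ)) - (moeb (g * NormedSpace.exp (τ • X)) (I • (1 : Matrix (Fin 2) (Fin 2) ℂ)))ᴴ))) * a) 0 0).re) s)))) 0, ?_, fun s hs => ?_⟩
  · -- holomorphy: on `{0 < re}` the `deriv` equals the product-rule term, holomorphic factor by factor
    have dc : ∀ c : ℂ, DifferentiableOn ℂ (fun _ : ℂ => c) {s : ℂ | 0 < s.re} := fun c => differentiableOn_const c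
    have hρc : ((((fun τ : ℝ => ‖(denom (g * NormedSpace.exp (τ • X)) (I • (1 : Matrix (Fin 2) (Fin 2) ℂ))).det‖) 0 : ℝ)) : ℂ) ≠ 0 := by exact_mod_cast hρ0.ne'
    have hqc : ((((fun τ : ℝ => 1 / ((((aᴴ * ((2 : ℂ) • ((2 * I)⁻¹ • (moeb (g * NormedSpace.exp (τ • X)) (I • (1 : Matrix (Fin 2) (Fin 2) ℂ)) - (moeb (g * NormedSpace.exp (τ • X)) (I • (1 : Matrix (Fin 2) (Fin 2) ℂ)))ᴴ))) * a) 1 1).re) - normSq ((aᴴ * ((2 : ℂ) • ((2 * I)⁻¹ • (moeb (g * NormedSpace.exp (τ • X)) (I • (1 : Matrix (Fin 2) (Fin 2) ℂ)) - (moeb (g * NormedSpace.exp (τ • X)) (I • (1 : Matrix (Fin 2) (Fin 2) ℂ)))ᴴ))) * a) 0 1) / (((aᴴ * ((2 : ℂ) • ((2 * I)⁻¹ • (moeb (g * NormedSpace.exp (τ • X)) (I • (1 : Matrix (Fin 2) (Fin 2) ℂ)) - (moeb (g * NormedSpace.exp (τ • X)) (I • (1 : Matrix (Fin 2) (Fin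 2) ℂ)))ᴴ))) * a) 0 0).re) : ℝ)) 0 : ℝ)) : ℂ) ≠ 0 := by exact_mod_cast hq0.ne'
    have hqc' : (1 / ((((((aᴴ * ((2 : ℂ) • ((2 * I)⁻¹ • (moeb (g * NormedSpace.exp ((0 : ℝ) • X)) (I • (1 : Matrix (Fin 2) (Fin 2) ℂ)) - (moeb (g * NormedSpace.exp ((0 : ℝ) • X)) (I • (1 : Matrix (Fin 2) (Fin 2) ℂ)))ᴴ))) * a) 1 1).re) - normSq ((aᴴ * ((2 : ℂ) • ((2 * I)⁻¹ • (moeb (g * NormedSpace.exp ((0 : ℝ) • X)) (I • (1 : Matrix (Fin 2) (Fin 2) ℂ)) - (moeb (g * NormedSpace.exp ((0 : ℝ) • X)) (I • (1 : Matrix (Fin 2) (Fin 2) ℂ)))ᴴ))) * a) 0 1) / (((aᴴ * ((2 : ℂ) • ((2 * I)⁻¹ • (moeb (g * NormedSpace.exp ((0 : ℝ) • X)) (I • (1 : Matrix (Fin 2) (Fin 2) ℂ)) - (moeb (g * NormedSpace.exp ((0 : ℝ) • X)) (I • (1 : Matrix (Fin 2) (Fin 2) ℂ)))ᴴ))) *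 a) 0 0).re) : ℝ)) : ℂ)) ≠ 0 := one_div_ne_zero (by exact_mod_cast (hqpos 0).ne')
    have hcs : Differentiable ℂ (fun s : ℂ => ((k : ℂ) - 2 * s - 2)) := ((differentiable_const _).sub ((differentiable_id).const_mul _)).sub_const _
    have hes : Differentiable ℂ (fun s : ℂ => ((s + 1 - k / 2) + (s + 1 + k / 2) - 2)) :=
      ((((differentiable_id).add_const _).sub_const _).add (((differentiable_id).add_const _).add_const _)).sub_const _
    have hA : DifferentiableOn ℂ (fun s : ℂ => ((((4 * Real.pi ^ 4 : ℝ)) : ℂ) * cexp ((Real.pi * I) * ((s + 1 - k / 2) - (s + 1 + k / 2))) *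
        ((Real.pi : ℂ)⁻¹ * (Complex.Gamma (s + 1 + k / 2))⁻¹) *
        ((Real.pi : ℂ)⁻¹ * (Complex.Gamma (s + 1 - k / 2))⁻¹ * (Complex.Gamma (s + 1 - k / 2 - 1))⁻¹))) {s : ℂ | 0 < s.re} := by
      refine Differentiable.differentiableOn ?_
      refine (((differentiable_const _).mul ?_).mul ?_).mul ?_
      · exact (((differentiable_const _).mul ((((differentiable_id).add_const _).sub_const _).sub
          (((differentiable_id).add_const _).add_const _)))).cexp
      · exact (differentiable_const _).mul (Complex.differentiable_one_div_Gamma.comp (((differentiable_id).add_const _).add_const _))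
      · refine ((differentiable_const _).mul ?_).mul ?_
        · exact Complex.differentiable_one_div_Gamma.comp (((differentiable_id).add_const _).sub_const _)
        · exact Complex.differentiable_one_div_Gamma.comp ((((differentiable_id).add_const _).sub_const _).sub_const _)
    have hX2v : DifferentiableOn ℂ (fun s : ℂ => (((((fun τ : ℝ => ‖(denom (g * NormedSpace.exp (τ • X)) (I • (1 : Matrix (Fin 2) (Fin 2) ℂ))).det‖) 0 : ℝ)) : ℂ) ^ ((k : ℂ) - 2 * s - 2))) {s : ℂ | 0 < s.re} :=
      Differentiable.differentiableOn fun s => (hcs s).const_cpow (Or.inl hρc)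
    have hX2d : DifferentiableOn ℂ (fun s : ℂ => (((k : ℂ) - 2 * s - 2) * ((((fun τ : ℝ => ‖(denom (g * NormedSpace.exp (τ • X)) (I • (1 : Matrix (Fin 2) (Fin 2) ℂ))).det‖) 0 : ℝ)) : ℂ) ^ (((k : ℂ) - 2 * s - 2) - 1) * ((deriv (fun τ : ℝ => ‖(denom (g * NormedSpace.exp (τ • X)) (I • (1 : Matrix (Fin 2) (Fin 2) ℂ))).det‖) 0 : ℝ) : ℂ))) {s : ℂ | 0 < s.re} :=
      Differentiable.differentiableOn ((hcs.mul fun s => ((hcs.sub_const 1) s).const_cpow (Or.inl hρc)).mul (differentiable_const _))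
    have hX6v : DifferentiableOn ℂ (fun s : ℂ => ((1 / ((((((aᴴ * ((2 : ℂ) • ((2 * I)⁻¹ • (moeb (g * NormedSpace.exp ((0 : ℝ) • X)) (I • (1 : Matrix (Fin 2) (Fin 2) ℂ)) - (moeb (g * NormedSpace.exp ((0 : ℝ) • X)) (I • (1 : Matrix (Fin 2) (Fin 2) ℂ)))ᴴ))) * a) 1 1).re) - normSq ((aᴴ * ((2 : ℂ) • ((2 * I)⁻¹ • (moeb (g * NormedSpace.exp ((0 : ℝ) • X)) (I • (1 : Matrix (Fin 2) (Fin 2) ℂ)) - (moeb (g * NormedSpace.exp ((0 : ℝ) • X)) (I • (1 : Matrix (Fin 2) (Fin 2) ℂ)))ᴴ))) * a) 0 1) / (((aᴴ * ((2 : ℂ) • ((2 * I)⁻¹ • (moeb (g * NormedSpace.exp ((0 : ℝ) • X)) (I • (1 : Matrix (Fin 2) (Fin 2) ℂ)) - (moeb (g * NormedSpace.exp ((0 : ℝ) • X)) (I • (1 : Matrix (Fin 2) (Fin 2) ℂ)))ᴴ))) * a) 0 0).re) : ℝ)) : ℂ)) ^ ((s + 1 - k / 2) + (s + 1 + k / 2)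 - 2))) {s : ℂ | 0 < s.re} :=
      Differentiable.differentiableOn fun s => (hes s).const_cpow (Or.inl hqc')
    have hX6d : DifferentiableOn ℂ (fun s : ℂ => (((s + 1 - k / 2) + (s + 1 + k / 2) - 2) * ((((fun τ : ℝ => 1 / ((((aᴴ * ((2 : ℂ) • ((2 * I)⁻¹ • (moeb (g * NormedSpace.exp (τ • X)) (I • (1 : Matrix (Fin 2) (Fin 2) ℂ)) - (moeb (g * NormedSpace.exp (τ • X)) (I • (1 : Matrix (Fin 2) (Fin 2) ℂ)))ᴴ))) * a) 1 1).re) - normSq ((aᴴ * ((2 : ℂ) • ((2 * I)⁻¹ • (moeb (g * NormedSpace.exp (τ • X)) (I • (1 : Matrix (Fin 2) (Fin 2) ℂ)) - (moeb (g * NormedSpace.exp (τ • X)) (I • (1 : Matrix (Fin 2) (Fin 2) ℂ)))ᴴ))) * a) 0 1) / (((aᴴ * ((2 : ℂ) • ((2 * I)⁻¹ • (moeb (g * NormedSpace.exp (τ • X)) (I • (1 : Matrix (Fin 2) (Fin 2) ℂ)) - (moeb (g * NormedSpace.exp (τ • X)) (I • (1 : Matrix (Fin 2) (Fin 2) ℂ)))ᴴ)))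 * a) 0 0).re) : ℝ)) 0 : ℝ)) : ℂ) ^ (((s + 1 - k / 2) + (s + 1 + k / 2) - 2) - 1) * ((deriv (fun τ : ℝ => 1 / ((((aᴴ * ((2 : ℂ) • ((2 * I)⁻¹ • (moeb (g * NormedSpace.exp (τ • X)) (I • (1 : Matrix (Fin 2) (Fin 2) ℂ)) - (moeb (g * NormedSpace.exp (τ • X)) (I • (1 : Matrix (Fin 2) (Fin 2) ℂ)))ᴴ))) * a) 1 1).re) - normSq ((aᴴ * ((2 : ℂ) • ((2 * I)⁻¹ • (moeb (g * NormedSpace.exp (τ • X)) (I • (1 : Matrix (Fin 2) (Fin 2) ℂ)) - (moeb (g * NormedSpace.exp (τ • X)) (I • (1 : Matrix (Fin 2) (Fin 2) ℂ)))ᴴ))) * a) 0 1) / (((aᴴ * ((2 : ℂ) • ((2 * I)⁻¹ • (moeb (g * NormedSpace.exp (τ • X)) (I • (1 : Matrix (Fin 2) (Fin 2) ℂ)) - (moeb (g * NormedSpace.exp (τ • X)) (I • (1 : Matrix (Fin 2) (Fin 2) ℂ)))ᴴ))) * a) 0 0).re) : ℝ)) 0 : ℝ) : ℂ))) {s : ℂ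 | 0 < s.re} :=
      Differentiable.differentiableOn ((hes.mul fun s => ((hes.sub_const 1) s).const_cpow (Or.inl hqc)).mul (differentiable_const _))
    have hG : DifferentiableOn ℂ (fun s : ℂ => (Complex.Gamma (2 * s))) {s : ℂ | 0 < s.re} := differentiableOn_Gamma_two_mul
    have hsub : {s : ℂ | 0 < s.re} ⊆ {s : ℂ | 1 - (N : ℝ) < ((1 + k / 2 : ℂ) + s).re} := by
      intro s hs
      simp only [Set.mem_setOf_eq, add_re, one_re, div_ofNat_re, intCast_re] at hs ⊢
      linarith
    have hX8v : DifferentiableOn ℂ (fun s : ℂ => (Φ (1 - k / 2) (1 + k / 2) ((fun τ : ℝ => (((aᴴ * ((2 : ℂ) • ((2 * I)⁻¹ • (moeb (g * NormedSpace.exp (τ • X)) (I • (1 : Matrix (Fin 2) (Fin 2) ℂ)) - (moeb (g * NormedSpace.exp (τ • X)) (I • (1 : Matrix (Fin 2) (Fin 2) ℂ)))ᴴ))) * a) 0 0).re)) 0) s)) {s : ℂ | 0 < s.re} := (hΦa _ _ _ (hppos 0)).mono hsub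
    have hX8d : DifferentiableOn ℂ (fun s : ℂ => (((deriv (fun τ : ℝ => (((aᴴ * ((2 : ℂ) • ((2 * I)⁻¹ • (moeb (g * NormedSpace.exp (τ • X)) (I • (1 : Matrix (Fin 2) (Fin 2) ℂ)) - (moeb (g * NormedSpace.exp (τ • X)) (I • (1 : Matrix (Fin 2) (Fin 2) ℂ)))ᴴ))) * a) 0 0).re)) 0 : ℝ) : ℂ) * (-((1 + (k : ℂ) / 2) + s - 1) * Φ (1 - k / 2) ((1 + (k : ℂ) / 2) + 1) ((fun τ : ℝ => (((aᴴ * ((2 : ℂ) • ((2 * I)⁻¹ • (moeb (g * NormedSpace.exp (τ • X)) (I • (1 : Matrix (Fin 2) (Fin 2) ℂ)) - (moeb (g * NormedSpace.exp (τ • X)) (I • (1 : Matrix (Fin 2) (Fin 2) ℂ)))ᴴ))) * a) 0 0).re)) 0) s))) {s : ℂ | 0 < s.re} :=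
      (differentiableOn_weightParamDeriv Φ hΦa (1 - k / 2) (1 + k / 2) (hppos 0) _).mono hsub
    have hE : DifferentiableOn ℂ (fun s : ℂ =>
      ((((((-k : ℤ)) : ℂ) * (fun τ : ℝ => (denom (g * NormedSpace.exp (τ • X)) (I • (1 : Matrix (Fin 2) (Fin 2) ℂ))).det) 0 ^ (-k - 1) * deriv (fun τ : ℝ => (denom (g * NormedSpace.exp (τ • X)) (I • (1 : Matrix (Fin 2) (Fin 2) ℂ))).det) 0) * (((((fun τ : ℝ => ‖(denom (g * NormedSpace.exp (τ • X)) (I • (1 : Matrix (Fin 2) (Fin 2) ℂ))).det‖) 0 : ℝ)) : ℂ) ^ ((k : ℂ) - 2 * s - 2)) + ((fun τ : ℝ => (denom (g * NormedSpace.exp (τ • X)) (I • (1 : Matrix (Fin 2) (Fin 2) ℂ))).det) 0 ^ (-k)) * (((k : ℂ) - 2 * s - 2) * ((((fun τ : ℝ => ‖(denom (g * NormedSpace.exp (τ • X)) (I • (1 : Matrix (Fin 2) (Fin 2) ℂ))).det‖) 0 : ℝ)) : ℂ) ^ (((k : ℂ) - 2 * s - 2) - 1) * ((deriv (fun τ :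 ℝ => ‖(denom (g * NormedSpace.exp (τ • X)) (I • (1 : Matrix (Fin 2) (Fin 2) ℂ))).det‖) 0 : ℝ) : ℂ))) * (cexp ((2 * Real.pi * I) * (fun τ : ℝ => ((-(a * hermTwo (t, 0, 0) * aᴴ)) * ((2 : ℂ)⁻¹ • (moeb (g * NormedSpace.exp (τ • X)) (I • (1 : Matrix (Fin 2) (Fin 2) ℂ)) + (moeb (g * NormedSpace.exp (τ • X)) (I • (1 : Matrix (Fin 2) (Fin 2) ℂ)))ᴴ))).trace) 0)) + ((fun τ : ℝ => (denom (g * NormedSpace.exp (τ • X)) (I • (1 : Matrix (Fin 2) (Fin 2) ℂ))).det) 0 ^ (-k)) * (((((fun τ : ℝ => ‖(denom (g * NormedSpace.exp (τ • X)) (I • (1 : Matrix (Fin 2) (Fin 2) ℂ))).det‖) 0 : ℝ)) : ℂ) ^ ((k : ℂ) - 2 * s - 2)) * (cexp ((2 * Real.pi * I) * (fun τ : ℝ => ((-(a * hermTwo (t, 0, 0) * aᴴ)) * ((2 : ℂ)⁻¹ • (moeb (g * NormedSpace.exp (τ • X)) (I • (1 : Matrix (Fin 2) (Fin 2) ℂ))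 + (moeb (g * NormedSpace.exp (τ • X)) (I • (1 : Matrix (Fin 2) (Fin 2) ℂ)))ᴴ))).trace) 0) * ((2 * Real.pi * I) * deriv (fun τ : ℝ => ((-(a * hermTwo (t, 0, 0) * aᴴ)) * ((2 : ℂ)⁻¹ • (moeb (g * NormedSpace.exp (τ • X)) (I • (1 : Matrix (Fin 2) (Fin 2) ℂ)) + (moeb (g * NormedSpace.exp (τ • X)) (I • (1 : Matrix (Fin 2) (Fin 2) ℂ)))ᴴ))).trace) 0))) *
        ((1 / 8 : ℂ) * (((((4 * Real.pi ^ 4 : ℝ)) : ℂ) * cexp ((Real.pi * I) * ((s + 1 - k / 2) - (s + 1 + k / 2))) *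
        ((Real.pi : ℂ)⁻¹ * (Complex.Gamma (s + 1 + k / 2))⁻¹) *
        ((Real.pi : ℂ)⁻¹ * (Complex.Gamma (s + 1 - k / 2))⁻¹ * (Complex.Gamma (s + 1 - k / 2 - 1))⁻¹)) * (((fun τ : ℝ => (Real.pi : ℂ) / (((aᴴ * ((2 : ℂ) • ((2 * I)⁻¹ • (moeb (g * NormedSpace.exp (τ • X)) (I • (1 : Matrix (Fin 2) (Fin 2) ℂ)) - (moeb (g * NormedSpace.exp (τ • X)) (I • (1 : Matrix (Fin 2) (Fin 2) ℂ)))ᴴ))) * a) 0 0).re) * cexp (-(((((aᴴ * ((2 : ℂ) • ((2 * I)⁻¹ • (moeb (g * NormedSpace.exp (τ • X)) (I • (1 : Matrix (Fin 2) (Fin 2) ℂ)) - (moeb (g * NormedSpace.exp (τ • X)) (I • (1 : Matrix (Fin 2) (Fin 2) ℂ)))ᴴ))) * a) 0 0).re) * (Real.pi * t) : ℝ) : ℂ))) 0) * (((1 / ((((((aᴴ * ((2 : ℂ) • ((2 * I)⁻¹ • (moeb (g * NormedSpace.exp ((0 : ℝ) • X)) (I • (1 : Matrix (Fin 2) (Fin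 2) ℂ)) - (moeb (g * NormedSpace.exp ((0 : ℝ) • X)) (I • (1 : Matrix (Fin 2) (Fin 2) ℂ)))ᴴ))) * a) 1 1).re) - normSq ((aᴴ * ((2 : ℂ) • ((2 * I)⁻¹ • (moeb (g * NormedSpace.exp ((0 : ℝ) • X)) (I • (1 : Matrix (Fin 2) (Fin 2) ℂ)) - (moeb (g * NormedSpace.exp ((0 : ℝ) • X)) (I • (1 : Matrix (Fin 2) (Fin 2) ℂ)))ᴴ))) * a) 0 1) / (((aᴴ * ((2 : ℂ) • ((2 * I)⁻¹ • (moeb (g * NormedSpace.exp ((0 : ℝ) • X)) (I • (1 : Matrix (Fin 2) (Fin 2) ℂ)) - (moeb (g * NormedSpace.exp ((0 : ℝ) • X)) (I • (1 : Matrix (Fin 2) (Fin 2) ℂ)))ᴴ))) * a) 0 0).re) : ℝ)) : ℂ)) ^ ((s + 1 - k / 2) + (s + 1 + k / 2) - 2)) * (Complex.Gamma (2 * s)))) * (Φ (1 - k / 2) (1 + k / 2) ((fun τ : ℝ => (((aᴴ * ((2 : ℂ) • ((2 * I)⁻¹ • (moeb (g * NormedSpace.exp (τ • X)) (I • (1 :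 Matrix (Fin 2) (Fin 2) ℂ)) - (moeb (g * NormedSpace.exp (τ • X)) (I • (1 : Matrix (Fin 2) (Fin 2) ℂ)))ᴴ))) * a) 0 0).re)) 0) s))) +
      ((fun τ : ℝ => (denom (g * NormedSpace.exp (τ • X)) (I • (1 : Matrix (Fin 2) (Fin 2) ℂ))).det) 0 ^ (-k)) * (((((fun τ : ℝ => ‖(denom (g * NormedSpace.exp (τ • X)) (I • (1 : Matrix (Fin 2) (Fin 2) ℂ))).det‖) 0 : ℝ)) : ℂ) ^ ((k : ℂ) - 2 * s - 2)) * (cexp ((2 * Real.pi * I) * (fun τ : ℝ => ((-(a * hermTwo (t, 0, 0) * aᴴ)) * ((2 : ℂ)⁻¹ • (moeb (g * NormedSpace.exp (τ • X)) (I • (1 : Matrix (Fin 2) (Fin 2) ℂ)) + (moeb (g * NormedSpace.exp (τ • X)) (I • (1 : Matrix (Fin 2) (Fin 2) ℂ)))ᴴ))).trace) 0)) *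
        ((1 / 8 : ℂ) * (((((4 * Real.pi ^ 4 : ℝ)) : ℂ) * cexp ((Real.pi * I) * ((s + 1 - k / 2) - (s + 1 + k / 2))) *
        ((Real.pi : ℂ)⁻¹ * (Complex.Gamma (s + 1 + k / 2))⁻¹) *
        ((Real.pi : ℂ)⁻¹ * (Complex.Gamma (s + 1 - k / 2))⁻¹ * (Complex.Gamma (s + 1 - k / 2 - 1))⁻¹)) * ((deriv (fun τ : ℝ => (Real.pi : ℂ) / (((aᴴ * ((2 : ℂ) • ((2 * I)⁻¹ • (moeb (g * NormedSpace.exp (τ • X)) (I • (1 : Matrix (Fin 2) (Fin 2) ℂ)) - (moeb (g * NormedSpace.exp (τ • X)) (I • (1 : Matrix (Fin 2) (Fin 2) ℂ)))ᴴ))) * a) 0 0).re) * cexp (-(((((aᴴ * ((2 : ℂ) • ((2 * I)⁻¹ • (moeb (g * NormedSpace.exp (τ • X)) (I • (1 : Matrix (Fin 2) (Fin 2) ℂ)) - (moeb (g * NormedSpace.exp (τ • X)) (I • (1 : Matrix (Fin 2) (Fin 2) ℂ)))ᴴ))) * a) 0 0).re) * (Real.pi * t) : ℝ) : ℂ)))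 0) * (((1 / ((((((aᴴ * ((2 : ℂ) • ((2 * I)⁻¹ • (moeb (g * NormedSpace.exp ((0 : ℝ) • X)) (I • (1 : Matrix (Fin 2) (Fin 2) ℂ)) - (moeb (g * NormedSpace.exp ((0 : ℝ) • X)) (I • (1 : Matrix (Fin 2) (Fin 2) ℂ)))ᴴ))) * a) 1 1).re) - normSq ((aᴴ * ((2 : ℂ) • ((2 * I)⁻¹ • (moeb (g * NormedSpace.exp ((0 : ℝ) • X)) (I • (1 : Matrix (Fin 2) (Fin 2) ℂ)) - (moeb (g * NormedSpace.exp ((0 : ℝ) • X)) (I • (1 : Matrix (Fin 2) (Fin 2) ℂ)))ᴴ))) * a) 0 1) / (((aᴴ * ((2 : ℂ) • ((2 * I)⁻¹ • (moeb (g * NormedSpace.exp ((0 : ℝ) • X)) (I • (1 : Matrix (Fin 2) (Fin 2) ℂ)) - (moeb (g * NormedSpace.exp ((0 : ℝ) • X)) (I • (1 : Matrix (Fin 2) (Fin 2) ℂ)))ᴴ))) * a) 0 0).re) : ℝ)) : ℂ)) ^ ((s + 1 - k / 2) + (s + 1 + k / 2) - 2)) * (Complex.Gamma (2 * s))) + ((fun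 τ : ℝ => (Real.pi : ℂ) / (((aᴴ * ((2 : ℂ) • ((2 * I)⁻¹ • (moeb (g * NormedSpace.exp (τ • X)) (I • (1 : Matrix (Fin 2) (Fin 2) ℂ)) - (moeb (g * NormedSpace.exp (τ • X)) (I • (1 : Matrix (Fin 2) (Fin 2) ℂ)))ᴴ))) * a) 0 0).re) * cexp (-(((((aᴴ * ((2 : ℂ) • ((2 * I)⁻¹ • (moeb (g * NormedSpace.exp (τ • X)) (I • (1 : Matrix (Fin 2) (Fin 2) ℂ)) - (moeb (g * NormedSpace.exp (τ • X)) (I • (1 : Matrix (Fin 2) (Fin 2) ℂ)))ᴴ))) * a) 0 0).re) * (Real.pi * t) : ℝ) : ℂ))) 0) * ((((s + 1 - k / 2) + (s + 1 + k / 2) - 2) * ((((fun τ : ℝ => 1 / ((((aᴴ * ((2 : ℂ) • ((2 * I)⁻¹ • (moeb (g * NormedSpace.exp (τ • X)) (I • (1 : Matrix (Fin 2) (Fin 2) ℂ)) - (moeb (g * NormedSpace.exp (τ • X)) (I • (1 : Matrix (Fin 2) (Fin 2) ℂ)))ᴴ))) * a) 1 1).re) - normSq ((aᴴ * ((2 :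 ℂ) • ((2 * I)⁻¹ • (moeb (g * NormedSpace.exp (τ • X)) (I • (1 : Matrix (Fin 2) (Fin 2) ℂ)) - (moeb (g * NormedSpace.exp (τ • X)) (I • (1 : Matrix (Fin 2) (Fin 2) ℂ)))ᴴ))) * a) 0 1) / (((aᴴ * ((2 : ℂ) • ((2 * I)⁻¹ • (moeb (g * NormedSpace.exp (τ • X)) (I • (1 : Matrix (Fin 2) (Fin 2) ℂ)) - (moeb (g * NormedSpace.exp (τ • X)) (I • (1 : Matrix (Fin 2) (Fin 2) ℂ)))ᴴ))) * a) 0 0).re) : ℝ)) 0 : ℝ)) : ℂ) ^ (((s + 1 - k / 2) + (s + 1 + k / 2) - 2) - 1) * ((deriv (fun τ : ℝ => 1 / ((((aᴴ * ((2 : ℂ) • ((2 * I)⁻¹ • (moeb (g * NormedSpace.exp (τ • X)) (I • (1 : Matrix (Fin 2) (Fin 2) ℂ)) - (moeb (g * NormedSpace.exp (τ • X)) (I • (1 : Matrix (Fin 2) (Fin 2) ℂ)))ᴴ))) * a) 1 1).re) - normSq ((aᴴ * ((2 : ℂ) • ((2 * I)⁻¹ • (moeb (g * NormedSpace.exp (τ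 • X)) (I • (1 : Matrix (Fin 2) (Fin 2) ℂ)) - (moeb (g * NormedSpace.exp (τ • X)) (I • (1 : Matrix (Fin 2) (Fin 2) ℂ)))ᴴ))) * a) 0 1) / (((aᴴ * ((2 : ℂ) • ((2 * I)⁻¹ • (moeb (g * NormedSpace.exp (τ • X)) (I • (1 : Matrix (Fin 2) (Fin 2) ℂ)) - (moeb (g * NormedSpace.exp (τ • X)) (I • (1 : Matrix (Fin 2) (Fin 2) ℂ)))ᴴ))) * a) 0 0).re) : ℝ)) 0 : ℝ) : ℂ)) * (Complex.Gamma (2 * s)))) * (Φ (1 - k / 2) (1 + k / 2) ((fun τ : ℝ => (((aᴴ * ((2 : ℂ) • ((2 * I)⁻¹ • (moeb (g * NormedSpace.exp (τ • X)) (I • (1 : Matrix (Fin 2) (Fin 2) ℂ)) - (moeb (g * NormedSpace.exp (τ • X)) (I • (1 : Matrix (Fin 2) (Fin 2) ℂ)))ᴴ))) * a) 0 0).re)) 0) s) +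
          ((((4 * Real.pi ^ 4 : ℝ)) : ℂ) * cexp ((Real.pi * I) * ((s + 1 - k / 2) - (s + 1 + k / 2))) *
        ((Real.pi : ℂ)⁻¹ * (Complex.Gamma (s + 1 + k / 2))⁻¹) *
        ((Real.pi : ℂ)⁻¹ * (Complex.Gamma (s + 1 - k / 2))⁻¹ * (Complex.Gamma (s + 1 - k / 2 - 1))⁻¹)) * (((fun τ : ℝ => (Real.pi : ℂ) / (((aᴴ * ((2 : ℂ) • ((2 * I)⁻¹ • (moeb (g * NormedSpace.exp (τ • X)) (I • (1 : Matrix (Fin 2) (Fin 2) ℂ)) - (moeb (g * NormedSpace.exp (τ • X)) (I • (1 : Matrix (Fin 2) (Fin 2) ℂ)))ᴴ))) * a) 0 0).re) * cexp (-(((((aᴴ * ((2 : ℂ) • ((2 * I)⁻¹ • (moeb (g * NormedSpace.exp (τ • X)) (I • (1 : Matrix (Fin 2) (Fin 2) ℂ)) - (moeb (g * NormedSpace.exp (τ • X)) (I • (1 : Matrix (Fin 2) (Fin 2) ℂ)))ᴴ))) * a) 0 0).re) * (Real.pi * t) : ℝ) : ℂ))) 0) * (((1 / ((((((aᴴ *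 ((2 : ℂ) • ((2 * I)⁻¹ • (moeb (g * NormedSpace.exp ((0 : ℝ) • X)) (I • (1 : Matrix (Fin 2) (Fin 2) ℂ)) - (moeb (g * NormedSpace.exp ((0 : ℝ) • X)) (I • (1 : Matrix (Fin 2) (Fin 2) ℂ)))ᴴ))) * a) 1 1).re) - normSq ((aᴴ * ((2 : ℂ) • ((2 * I)⁻¹ • (moeb (g * NormedSpace.exp ((0 : ℝ) • X)) (I • (1 : Matrix (Fin 2) (Fin 2) ℂ)) - (moeb (g * NormedSpace.exp ((0 : ℝ) • X)) (I • (1 : Matrix (Fin 2) (Fin 2) ℂ)))ᴴ))) * a) 0 1) / (((aᴴ * ((2 : ℂ) • ((2 * I)⁻¹ • (moeb (g * NormedSpace.exp ((0 : ℝ) • X)) (I • (1 : Matrix (Fin 2) (Fin 2) ℂ)) - (moeb (g * NormedSpace.exp ((0 : ℝ) • X)) (I • (1 : Matrix (Fin 2) (Fin 2) ℂ)))ᴴ))) * a) 0 0).re) : ℝ)) : ℂ)) ^ ((s + 1 - k / 2) + (s + 1 + k / 2) - 2)) * (Complex.Gamma (2 * s)))) * (((deriv (fun τ : ℝ => (((aᴴ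 * ((2 : ℂ) • ((2 * I)⁻¹ • (moeb (g * NormedSpace.exp (τ • X)) (I • (1 : Matrix (Fin 2) (Fin 2) ℂ)) - (moeb (g * NormedSpace.exp (τ • X)) (I • (1 : Matrix (Fin 2) (Fin 2) ℂ)))ᴴ))) * a) 0 0).re)) 0 : ℝ) : ℂ) * (-((1 + (k : ℂ) / 2) + s - 1) * Φ (1 - k / 2) ((1 + (k : ℂ) / 2) + 1) ((fun τ : ℝ => (((aᴴ * ((2 : ℂ) • ((2 * I)⁻¹ • (moeb (g * NormedSpace.exp (τ • X)) (I • (1 : Matrix (Fin 2) (Fin 2) ℂ)) - (moeb (g * NormedSpace.exp (τ • X)) (I • (1 : Matrix (Fin 2) (Fin 2) ℂ)))ᴴ))) * a) 0 0).re)) 0) s))))) {s : ℂ | 0 < s.re} :=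
      ((((((dc _).mul hX2v).add ((dc _).mul hX2d)).mul (dc _)).add (((dc _).mul hX2v).mul (dc _))).mul
        ((dc _).mul ((hA.mul ((dc _).mul (hX6v.mul hG))).mul hX8v))).add
      ((((dc _).mul hX2v).mul (dc _)).mul ((dc _).mul
        (((hA.mul ((((dc _).mul (hX6v.mul hG))).add ((dc _).mul (hX6d.mul hG)))).mul hX8v).add
          ((hA.mul ((dc _).mul (hX6v.mul hG))).mul hX8d))))
    refine hE.congr fun s hs => ?_
    have hcongr : HasDerivAt (fun τ : ℝ =>
        ((denom (g * NormedSpace.exp (τ • X)) (I • (1 : Matrix (Fin 2) (Fin 2) ℂ))).det ^ (-k) *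
            (((‖(denom (g * NormedSpace.exp (τ • X)) (I • (1 : Matrix (Fin 2) (Fin 2) ℂ))).det‖ : ℝ)) : ℂ) ^ ((k : ℂ) - 2 * s - 2) *
            cexp ((2 * Real.pi * I) * ((-(a * hermTwo (t, 0, 0) * aᴴ)) * ((2 : ℂ)⁻¹ • (moeb (g * NormedSpace.exp (τ • X)) (I • (1 : Matrix (Fin 2) (Fin 2) ℂ)) + (moeb (g * NormedSpace.exp (τ • X)) (I • (1 : Matrix (Fin 2) (Fin 2) ℂ)))ᴴ))).trace)) *
          ((1 / 8 : ℂ) * ((((4 * Real.pi ^ 4 : ℝ)) : ℂ) * cexp ((Real.pi * I) * ((s + 1 - k / 2) - (s + 1 + k / 2))) *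
            ((Real.pi : ℂ)⁻¹ * (Complex.Gamma (s + 1 + k / 2))⁻¹) *
            ((Real.pi : ℂ)⁻¹ * (Complex.Gamma (s + 1 - k / 2))⁻¹ * (Complex.Gamma (s + 1 - k / 2 - 1))⁻¹) *
            ((Real.pi : ℂ) / (((aᴴ * ((2 : ℂ) • ((2 * I)⁻¹ • (moeb (g * NormedSpace.exp (τ • X)) (I • (1 : Matrix (Fin 2) (Fin 2) ℂ)) - (moeb (g * NormedSpace.exp (τ • X)) (I • (1 : Matrix (Fin 2) (Fin 2) ℂ)))ᴴ))) * a) 0 0).re) * cexp (-(((((aᴴ * ((2 : ℂ) • ((2 * I)⁻¹ • (moeb (g * NormedSpace.exp (τ • X)) (I • (1 : Matrix (Fin 2) (Fin 2) ℂ)) - (moeb (g * NormedSpace.exp (τ • X)) (I • (1 : Matrix (Fin 2) (Fin 2) ℂ)))ᴴ))) * a) 0 0).re) * (Real.pi * t) : ℝ) : ℂ)) *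
              ((1 / (((((aᴴ * ((2 : ℂ) • ((2 * I)⁻¹ • (moeb (g * NormedSpace.exp (τ • X)) (I • (1 : Matrix (Fin 2) (Fin 2) ℂ)) - (moeb (g * NormedSpace.exp (τ • X)) (I • (1 : Matrix (Fin 2) (Fin 2) ℂ)))ᴴ))) * a) 1 1).re) - normSq ((aᴴ * ((2 : ℂ) • ((2 * I)⁻¹ • (moeb (g * NormedSpace.exp (τ • X)) (I • (1 : Matrix (Fin 2) (Fin 2) ℂ)) - (moeb (g * NormedSpace.exp (τ • X)) (I • (1 : Matrix (Fin 2) (Fin 2) ℂ)))ᴴ))) * a) 0 1) / (((aᴴ * ((2 : ℂ) • ((2 * I)⁻¹ • (moeb (g * NormedSpace.exp (τ • X)) (I • (1 : Matrix (Fin 2) (Fin 2) ℂ)) - (moeb (g * NormedSpace.exp (τ • X)) (I • (1 : Matrix (Fin 2) (Fin 2) ℂ)))ᴴ))) * a) 0 0).re) : ℝ) : ℂ)) ^ ((s + 1 - k / 2) + (s + 1 + k / 2) - 2) * Complex.Gamma (2 * s)) *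
            Φ (1 - k / 2) (1 + k / 2) (((aᴴ * ((2 : ℂ) • ((2 * I)⁻¹ • (moeb (g * NormedSpace.exp (τ • X)) (I • (1 : Matrix (Fin 2) (Fin 2) ℂ)) - (moeb (g * NormedSpace.exp (τ • X)) (I • (1 : Matrix (Fin 2) (Fin 2) ℂ)))ᴴ))) * a) 0 0).re) s)))) _ 0 :=
      (key s hs).congr_of_eventuallyEq (Filter.Eventually.of_forall fun τ => by
        beta_reduce
        first
          | rfl
          | ring)
    rw [hcongr.deriv]
  · -- the derivative exists: from `key`
    have hcongr : HasDerivAt (fun τ : ℝ =>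
        ((denom (g * NormedSpace.exp (τ • X)) (I • (1 : Matrix (Fin 2) (Fin 2) ℂ))).det ^ (-k) *
            (((‖(denom (g * NormedSpace.exp (τ • X)) (I • (1 : Matrix (Fin 2) (Fin 2) ℂ))).det‖ : ℝ)) : ℂ) ^ ((k : ℂ) - 2 * s - 2) *
            cexp ((2 * Real.pi * I) * ((-(a * hermTwo (t, 0, 0) * aᴴ)) * ((2 : ℂ)⁻¹ • (moeb (g * NormedSpace.exp (τ • X)) (I • (1 : Matrix (Fin 2) (Fin 2) ℂ)) + (moeb (g * NormedSpace.exp (τ • X)) (I • (1 : Matrix (Fin 2) (Fin 2) ℂ)))ᴴ))).trace)) *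
          ((1 / 8 : ℂ) * ((((4 * Real.pi ^ 4 : ℝ)) : ℂ) * cexp ((Real.pi * I) * ((s + 1 - k / 2) - (s + 1 + k / 2))) *
            ((Real.pi : ℂ)⁻¹ * (Complex.Gamma (s + 1 + k / 2))⁻¹) *
            ((Real.pi : ℂ)⁻¹ * (Complex.Gamma (s + 1 - k / 2))⁻¹ * (Complex.Gamma (s + 1 - k / 2 - 1))⁻¹) *
            ((Real.pi : ℂ) / (((aᴴ * ((2 : ℂ) • ((2 * I)⁻¹ • (moeb (g * NormedSpace.exp (τ • X)) (I • (1 : Matrix (Fin 2) (Fin 2) ℂ)) - (moeb (g * NormedSpace.exp (τ • X)) (I • (1 : Matrix (Fin 2) (Fin 2) ℂ)))ᴴ))) * a) 0 0).re) * cexp (-(((((aᴴ * ((2 : ℂ) • ((2 * I)⁻¹ • (moeb (g * NormedSpace.exp (τ • X)) (I • (1 : Matrix (Fin 2) (Fin 2) ℂ)) - (moeb (g * NormedSpace.exp (τ • X)) (I • (1 : Matrix (Fin 2) (Fin 2) ℂ)))ᴴ))) * a) 0 0).re) * (Real.pi * t) : ℝ) : ℂ)) *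
              ((1 / (((((aᴴ * ((2 : ℂ) • ((2 * I)⁻¹ • (moeb (g * NormedSpace.exp (τ • X)) (I • (1 : Matrix (Fin 2) (Fin 2) ℂ)) - (moeb (g * NormedSpace.exp (τ • X)) (I • (1 : Matrix (Fin 2) (Fin 2) ℂ)))ᴴ))) * a) 1 1).re) - normSq ((aᴴ * ((2 : ℂ) • ((2 * I)⁻¹ • (moeb (g * NormedSpace.exp (τ • X)) (I • (1 : Matrix (Fin 2) (Fin 2) ℂ)) - (moeb (g * NormedSpace.exp (τ • X)) (I • (1 : Matrix (Fin 2) (Fin 2) ℂ)))ᴴ))) * a) 0 1) / (((aᴴ * ((2 : ℂ) • ((2 * I)⁻¹ • (moeb (g * NormedSpace.exp (τ • X)) (I • (1 : Matrix (Fin 2) (Fin 2) ℂ)) - (moeb (g * NormedSpace.exp (τ • X)) (I • (1 : Matrix (Fin 2) (Fin 2) ℂ)))ᴴ))) * a) 0 0).re) : ℝ) : ℂ)) ^ ((s + 1 - k / 2) + (s + 1 + k / 2) - 2) * Complex.Gamma (2 * s)) *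
            Φ (1 - k / 2) (1 + k / 2) (((aᴴ * ((2 : ℂ) • ((2 * I)⁻¹ • (moeb (g * NormedSpace.exp (τ • X)) (I • (1 : Matrix (Fin 2) (Fin 2) ℂ)) - (moeb (g * NormedSpace.exp (τ • X)) (I • (1 : Matrix (Fin 2) (Fin 2) ℂ)))ᴴ))) * a) 0 0).re) s)))) _ 0 :=
      (key s hs).congr_of_eventuallyEq (Filter.Eventually.of_forall fun τ => by
        beta_reduce
        first
          | rfl
          | ring)
    exact hcongr.differentiableAt.hasDerivAt

end Summit.HodgeConjecture.HodgeConjecture.Cruxes.HLiu418.K2LiuArchTwistedScalarBlockRayDerivNeg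

end
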